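import Literature.LinearAlgebra.QuadraticForm.PosComplexStructuresTorusFamilyMultiplication
import Literature.LinearAlgebra.QuadraticForm.PosComplexStructuresTorusFamilyTorsionCovering
import Literature.LinearAlgebra.QuadraticForm.PosComplexStructuresTorusFamilyProper
import Mathlib.Topology.Covering.Quotient
import HarnessLib

/-!
# Multiplication by `N` on Deligne's family `Γ\B → Γ\B` is a Galois covering map with group the
# `N`-torsion `N⁻¹V(ℤ)/V(ℤ)` (`Γ ≤ Γ(N)` torsion-free), of degree `N^{dim V}`; the torus case `V/V(ℤ)`

Topic `LinearAlgebra/QuadraticForm`, sequel of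
`QuadraticForm/PosComplexStructuresTorusFamilyMultiplication` («multiplication by `N`»
`familyNsmul N : Γ\B → Γ\B`, `[(J, t)] ↦ [(J, N t)]`, is onto and `N^{dim V}`-to-one over a
torsion-free `Γ`), `…TorusFamilyLevelStructure` (`Γ(N)` fixes the `N`-torsion `torusTorsion Λ N`
pointwise), `…TorusFamilyTorsionCovering` (`Γ\B` is Hausdorff for every `Γ`; the `N`-torsion is
finite) and `…TorusFamilyProper` (`Γ\B → Γ\X⁺` is proper).

SOURCES (held, read at the page). P. Deligne (notes by J. S. Milne), *Hodge cycles on abelian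
varieties*, LNM 900 (1982) [Deligne1982HodgeCycles], proof of Thm. 4.8 p. 50 (held
`paper:doi-10-1007-978-3-540-38955-2-3` p0034): the family «`ₙB → ₙX⁺` which is an algebraic family of
abelian varieties» with its level structure «`k₁ : Aₙ(ℂ) = H₁(A, ℤ/nℤ) → V(ℤ)/nV(ℤ)`».
H. Lange, *Abelian Varieties over the Complex Numbers* (2023) [Lange2023AbelianVarietiesComplex]
§1.1.2, Prop. 1.1.14 («`X_n ≅ (ℤ/nℤ)^{2g}`»: `n_X` is an isogeny of degree `n^{2g}`, an étale covering
with group `X_n`). A. Hatcher, *Algebraic Topology* (2002) [HatcherAT2002] §1.3 Prop. 1.40 (a free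
properly discontinuous action gives a normal covering `Y → Y/G` with group `G`).

THIS FILE, for Deligne's data (`V`, `k`, `ψ`, a full lattice `Λ = V(ℤ)`), `N ≥ 1` and `G ≤ Γ(1)`:

* §1 the torus: ★ `isAddQuotientCoveringMap_nsmul_latticeTorus` — **`t ↦ N t` on `V(ℝ)/V(ℤ)` is a
  quotient covering map for the translation action of its kernel, the `N`-torsion** (Mathlib:
  a quotient map which is a group endomorphism with discrete kernel), hence a covering map
  (`isCoveringMap_nsmul_latticeTorus`), a local homeomorphism and an open map;
* §2 the family, EVERY `G`: `isOpenMap_familyNsmul`, `isQuotientMap_familyNsmul`,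
  `isProperMap_familyNsmul`, `isClosedMap_familyNsmul`, `locallyCompactSpace_familySpace`;
* §3 `G ≤ Γ(N)`: the TRANSLATION ACTION of the `N`-torsion `N⁻¹V(ℤ)/V(ℤ)` on `G\B`,
  `[(J, t)] ↦ [(J, a + t)]` (`torsionTranslation hG`, a DEFINITION of an `AddAction` summoned with
  `letI`; well defined exactly because `Γ(N)` fixes the `N`-torsion), continuous, properly
  discontinuous (finite group), FREE over a torsion-free `G` (`isCancelVAdd_torsionTranslation`), and
  `familyNsmul_eq_familyNsmul_iff_mem_orbit` — the fibres of `N` are exactly the orbits;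
* §4 ★★ `isAddQuotientCoveringMap_familyNsmul` — **for `G ≤ Γ(N)` torsion-free, multiplication by
  `N` on `G\B` is a Galois (quotient) covering map with group `N⁻¹V(ℤ)/V(ℤ) ≅ (ℤ/N)^{dim V}`**;
  `isCoveringMap_familyNsmul`; Deligne's `ₙB` (`n ≥ 3`, `N ∣ n`): `isCoveringMap_levelFamilyNsmul`.

Definitions with bodies (`torsionTranslation`), theorems; no `sorry`; no named facts; no instances;
no notation.

## References

* [Deligne1982HodgeCycles] P. Deligne (notes by J. S. Milne), *Hodge cycles on abelian varieties*,
  LNM 900 (1982), proof of Thm. 4.8, p. 50.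
* [Lange2023AbelianVarietiesComplex] H. Lange, *Abelian Varieties over the Complex Numbers*,
  Springer 2023, §1.1.2 Prop. 1.1.14.
* [HatcherAT2002] A. Hatcher, *Algebraic Topology*, CUP 2002, §1.3 Prop. 1.40.
-/

noncomputable section

namespace Literature.LinearAlgebra.QuadraticForm

open Set Function MulAction
open _root_.Topology

variable {V : Type*} [NormedAddCommGroup V] [NormedSpace ℝ V]

/-! ### §1 Multiplication by `N` on the torus `V(ℝ)/V(ℤ)` -/

section Torus

variable (Λ : Submodule ℤ V)

/-- `t ↦ N t` on `V(ℝ)/V(ℤ)` is a quotient map for `N ≠ 0` (it is covered by the homeomorphism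
`v ↦ N v` of `V(ℝ)`). [cite: Lange2023AbelianVarietiesComplex, §1.1.2 Prop. 1.1.14] -/
theorem isQuotientMap_nsmul_latticeTorus {N : ℕ} (hN : N ≠ 0) :
    IsQuotientMap fun t : latticeTorus Λ ↦ N • t :=
  (IsUnit.mk0 (N : ℝ) (Nat.cast_ne_zero.2 hN)).isQuotientMap_nsmul
    (QuotientAddGroup.mk' Λ.toAddSubgroup) isQuotientMap_quotient_mk' N

omit [NormedSpace ℝ V] in
/-- The kernel of `t ↦ N t` on the torus is the `N`-torsion `N⁻¹V(ℤ)/V(ℤ)`.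
[cite: Lange2023AbelianVarietiesComplex, §1.1.2 Prop. 1.1.14] -/
theorem ker_nsmulAddMonoidHom_latticeTorus (N : ℕ) :
    (nsmulAddMonoidHom (α := latticeTorus Λ) N).ker = torusTorsion Λ N := by
  ext t
  rw [AddMonoidHom.mem_ker, nsmulAddMonoidHom_apply, mem_torusTorsion_iff]

variable [FiniteDimensional ℝ V] [DiscreteTopology Λ] [IsZLattice ℝ Λ]

/-- ★ **`t ↦ N t` on `V(ℝ)/V(ℤ)` is a quotient covering map for the translation action of its kernel,
the `N`-torsion** (`N ≥ 1`; full lattice): a quotient map which is a group endomorphism with finite,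
hence discrete, kernel. [cite: Lange2023AbelianVarietiesComplex, §1.1.2 Prop. 1.1.14]
[cite: HatcherAT2002, §1.3 Prop. 1.40] -/
theorem isAddQuotientCoveringMap_nsmul_latticeTorus (N : ℕ) [NeZero N] :
    IsAddQuotientCoveringMap (nsmulAddMonoidHom (α := latticeTorus Λ) N)
      (nsmulAddMonoidHom (α := latticeTorus Λ) N).ker := by
  haveI := t2Space_latticeTorus Λ
  haveI := finite_torusTorsion Λ N
  refine (isQuotientMap_nsmul_latticeTorus Λ (NeZero.ne N)).isAddQuotientCoveringMap_of_isDiscrete_ker_addMonoidHom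
    (f := nsmulAddMonoidHom (α := latticeTorus Λ) N) ?_
  rw [ker_nsmulAddMonoidHom_latticeTorus]
  exact (Set.toFinite (torusTorsion Λ N : Set (latticeTorus Λ))).isDiscrete

/-- ★ **`t ↦ N t` on `V(ℝ)/V(ℤ)` is a covering map** (`N ≥ 1`). [cite: Lange2023AbelianVarietiesComplex, §1.1.2 Prop. 1.1.14] -/
theorem isCoveringMap_nsmul_latticeTorus (N : ℕ) [NeZero N] :
    IsCoveringMap fun t : latticeTorus Λ ↦ N • t :=
  (isAddQuotientCoveringMap_nsmul_latticeTorus Λ N).isCoveringMap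

/-- `t ↦ N t` on the torus is a local homeomorphism (`N ≥ 1`). [cite: Lange2023AbelianVarietiesComplex, §1.1.2 Prop. 1.1.14] -/
theorem isLocalHomeomorph_nsmul_latticeTorus (N : ℕ) [NeZero N] :
    IsLocalHomeomorph fun t : latticeTorus Λ ↦ N • t :=
  (isCoveringMap_nsmul_latticeTorus Λ N).isLocalHomeomorph

/-- `t ↦ N t` on the torus is an open map (`N ≥ 1`). [cite: Lange2023AbelianVarietiesComplex, §1.1.2 Prop. 1.1.14] -/
theorem isOpenMap_nsmul_latticeTorus (N : ℕ) [NeZero N] :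
    IsOpenMap fun t : latticeTorus Λ ↦ N • t :=
  (isCoveringMap_nsmul_latticeTorus Λ N).isOpenMap

/-- Every fibre of `t ↦ N t` on the torus has `N^{dim V}` points (restated from the predecessor for the
covering map). [cite: Lange2023AbelianVarietiesComplex, §1.1.2 Prop. 1.1.14] -/
theorem ncard_preimage_nsmul_latticeTorus_singleton (N : ℕ) [NeZero N] (t₀ : latticeTorus Λ) :
    ((fun t : latticeTorus Λ ↦ N • t) ⁻¹' {t₀}).ncard = N ^ Module.finrank ℝ V :=
  ncard_setOf_nsmul_eq_latticeTorus Λ N t₀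

end Torus

namespace arithmeticGroup

variable {k : V →L[ℝ] V} {ψ : LinearMap.BilinForm ℝ V} {Λ : Submodule ℤ V} {N : ℕ}
variable {G : Subgroup (arithmeticGroup k ψ Λ)}

/-! ### §2 Multiplication by `N` on `G\B`: open, quotient, proper (every `G`) -/

/-- `familyNsmul N` is induced by `(J, t) ↦ (J, N t)` on `X⁺ × V/V(ℤ)`:
`familyNsmul N ∘ familyMk = familyMk ∘ Prod.map id (N • ·)`. [cite: Deligne1982HodgeCycles, proof of Thm. 4.8, p. 50] -/
theorem familyNsmul_comp_familyMk (N : ℕ) :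
    familyNsmul k ψ Λ N G ∘ familyMk k ψ Λ G = familyMk k ψ Λ G ∘ Prod.map id (fun t : latticeTorus Λ ↦ N • t) :=
  funext fun _ ↦ rfl

section Topology

variable [FiniteDimensional ℝ V] [DiscreteTopology Λ] [IsZLattice ℝ Λ]

/-- **`familyNsmul N : G\B → G\B` is an open map** (`N ≥ 1`, every `G`): the image of an open set is
the image under the open quotient map `familyMk` of the image of its (open) preimage under the open
map `(J, t) ↦ (J, N t)`. [cite: Deligne1982HodgeCycles, proof of Thm. 4.8, p. 50] -/
theorem isOpenMap_familyNsmul (N : ℕ) [NeZero N] : IsOpenMap (familyNsmul k ψ Λ N G) := by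
  intro O hO
  have h1 : familyNsmul k ψ Λ N G '' O =
      (familyMk k ψ Λ G ∘ Prod.map id (fun t : latticeTorus Λ ↦ N • t)) '' (familyMk k ψ Λ G ⁻¹' O) := by
    rw [← familyNsmul_comp_familyMk, image_comp, image_preimage_eq _ surjective_familyMk]
  rw [h1, image_comp]
  exact isOpenQuotientMap_familyMk.isOpenMap _
    ((IsOpenMap.id.prodMap (isOpenMap_nsmul_latticeTorus Λ N)) _ (hO.preimage continuous_familyMk))

/-- `familyNsmul N` is a quotient map (`N ≥ 1`; open, continuous, onto).
[cite: Deligne1982HodgeCycles, proof of Thm. 4.8, p. 50] -/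
theorem isQuotientMap_familyNsmul (N : ℕ) [NeZero N] : IsQuotientMap (familyNsmul k ψ Λ N G) :=
  (isOpenMap_familyNsmul N).isQuotientMap (continuous_familyNsmul N) (surjective_familyNsmul N G)

/-- **`familyNsmul N` is a PROPER map** (every `G`, every `N`): `familyProj ∘ familyNsmul N = familyProj`
is proper and `G\B` is Hausdorff. [cite: Deligne1982HodgeCycles, proof of Thm. 4.8, p. 50] -/
theorem isProperMap_familyNsmul (N : ℕ) : IsProperMap (familyNsmul k ψ Λ N G) := by
  haveI := t2Space_familySpace' (k := k) (ψ := ψ) (Λ := Λ) G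
  refine isProperMap_of_comp_of_t2 (continuous_familyNsmul N) continuous_familyProj ?_
  have : familyProj k ψ Λ G ∘ familyNsmul k ψ Λ N G = familyProj k ψ Λ G :=
    funext fun q ↦ familyProj_familyNsmul N q
  rw [this]
  exact isProperMap_familyProj G

/-- `familyNsmul N` is a closed map (every `G`, every `N`). [cite: Deligne1982HodgeCycles, proof of Thm. 4.8, p. 50] -/
theorem isClosedMap_familyNsmul (N : ℕ) : IsClosedMap (familyNsmul k ψ Λ N G) :=
  (isProperMap_familyNsmul N).isClosedMap

omit [DiscreteTopology Λ] [IsZLattice ℝ Λ] in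
/-- **`G\B` is locally compact** (every `G`): the open quotient of the locally compact
`X⁺ × V(ℝ)/V(ℤ)`. [cite: Deligne1982HodgeCycles, proof of Thm. 4.8, p. 50] -/
theorem locallyCompactSpace_familySpace (G : Subgroup (arithmeticGroup k ψ Λ)) :
    LocallyCompactSpace (FamilySpace k ψ Λ G) :=
  isOpenQuotientMap_familyMk.locallyCompactSpace

end Topology

/-! ### §3 The translation action of the `N`-torsion on `G\B` for `G ≤ Γ(N)` -/

section Translation

variable (hG : G ≤ (levelSubgroup k ψ Λ N).subgroupOf (arithmeticGroup k ψ Λ))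
include hG

/-- **The translation action of `N⁻¹V(ℤ)/V(ℤ)` on `G\B` for `G ≤ Γ(N)`**: `a +ᵥ [(J, t)] = [(J, a + t)]`,
well defined because every `γ ∈ Γ(N)` fixes `a` (`γ(a + t) = a + γ t`). A DEFINITION of an
`AddAction`, not an instance: summoned with `letI := torsionTranslation hG`.
[cite: Deligne1982HodgeCycles, proof of Thm. 4.8, p. 50] [cite: HatcherAT2002, §1.3 Prop. 1.40] -/
@[reducible] def torsionTranslation [NeZero N] : AddAction (torusTorsion Λ N) (FamilySpace k ψ Λ G) where
  vadd a := letI := torusAction k ψ Λ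
    Quotient.map' (fun p : posComplexStructures k ψ × latticeTorus Λ ↦ (p.1, (a : latticeTorus Λ) + p.2))
      (by
        rintro p q ⟨γ, rfl⟩
        refine ⟨γ, Prod.ext rfl ?_⟩
        change torusMap (γ : arithmeticGroup k ψ Λ) ((a : latticeTorus Λ) + q.2) =
          (a : latticeTorus Λ) + torusMap (γ : arithmeticGroup k ψ Λ) q.2
        rw [map_add, torusMap_eq_self_of_le hG γ a.2])
  zero_vadd q := by
    obtain ⟨⟨J, t⟩, rfl⟩ := surjective_familyMk q
    change familyMk k ψ Λ G (J, ((0 : torusTorsion Λ N) : latticeTorus Λ) + t) = familyMk k ψ Λ G (J, t)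
    rw [ZeroMemClass.coe_zero, zero_add]
  add_vadd a b q := by
    obtain ⟨⟨J, t⟩, rfl⟩ := surjective_familyMk q
    change familyMk k ψ Λ G (J, ((a + b : torusTorsion Λ N) : latticeTorus Λ) + t) =
      familyMk k ψ Λ G (J, (a : latticeTorus Λ) + ((b : latticeTorus Λ) + t))
    rw [AddMemClass.coe_add, add_assoc]

/-- Under `torsionTranslation`, `a +ᵥ [(J, t)] = [(J, a + t)]`. [cite: Deligne1982HodgeCycles, proof of Thm. 4.8, p. 50] -/
theorem torsionTranslation_familyMk [NeZero N] (a : torusTorsion Λ N) (J : posComplexStructures k ψ)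
    (t : latticeTorus Λ) :
    (letI := torsionTranslation hG; a +ᵥ familyMk k ψ Λ G (J, t)) =
      familyMk k ψ Λ G (J, (a : latticeTorus Λ) + t) := rfl

/-- The translations are continuous. [cite: Deligne1982HodgeCycles, proof of Thm. 4.8, p. 50] -/
theorem continuousConstVAdd_torsionTranslation [NeZero N] :
    letI := torsionTranslation hG
    ContinuousConstVAdd (torusTorsion Λ N) (FamilySpace k ψ Λ G) := by
  letI := torsionTranslation hG
  refine ⟨fun a ↦ ?_⟩
  exact continuous_quot_lift _ (continuous_quot_mk.comp
    (continuous_fst.prodMk (continuous_const.add continuous_snd)))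

/-- Translations cover the identity of the base: `familyProj (a +ᵥ q) = familyProj q`.
[cite: Deligne1982HodgeCycles, proof of Thm. 4.8, p. 50] -/
@[simp] theorem familyProj_torsionTranslation [NeZero N] (a : torusTorsion Λ N) (q : FamilySpace k ψ Λ G) :
    familyProj k ψ Λ G (letI := torsionTranslation hG; a +ᵥ q) = familyProj k ψ Λ G q := by
  obtain ⟨⟨J, t⟩, rfl⟩ := surjective_familyMk q
  rfl

/-- Translations by `N`-torsion points do not change `N q`: `N (a +ᵥ q) = N q`.
[cite: Deligne1982HodgeCycles, proof of Thm. 4.8, p. 50] -/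
@[simp] theorem familyNsmul_torsionTranslation [NeZero N] (a : torusTorsion Λ N)
    (q : FamilySpace k ψ Λ G) :
    familyNsmul k ψ Λ N G (letI := torsionTranslation hG; a +ᵥ q) = familyNsmul k ψ Λ N G q := by
  obtain ⟨⟨J, t⟩, rfl⟩ := surjective_familyMk q
  rw [torsionTranslation_familyMk, familyNsmul_familyMk, familyNsmul_familyMk, nsmul_add,
    (mem_torusTorsion_iff.1 a.2), zero_add]

/-- The translation action of the FINITE group `N⁻¹V(ℤ)/V(ℤ)` is properly discontinuous.
[cite: HatcherAT2002, §1.3 Prop. 1.40] -/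
theorem properlyDiscontinuousVAdd_torsionTranslation [FiniteDimensional ℝ V] [DiscreteTopology Λ]
    [IsZLattice ℝ Λ] [NeZero N] :
    letI := torsionTranslation hG
    ProperlyDiscontinuousVAdd (torusTorsion Λ N) (FamilySpace k ψ Λ G) := by
  letI := torsionTranslation hG
  haveI := finite_torusTorsion Λ N
  exact ⟨fun _ _ ↦ Set.toFinite _⟩

/-- ★ **The fibres of `N` are the orbits of the `N`-torsion**: `N q₁ = N q₂` iff `q₁ = a +ᵥ q₂` for some
`N`-torsion point `a` (`G ≤ Γ(N)`). [cite: Deligne1982HodgeCycles, proof of Thm. 4.8, p. 50]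
[cite: Lange2023AbelianVarietiesComplex, §1.1.2 Prop. 1.1.14] -/
theorem familyNsmul_eq_familyNsmul_iff_mem_orbit [NeZero N] (q₁ q₂ : FamilySpace k ψ Λ G) :
    familyNsmul k ψ Λ N G q₁ = familyNsmul k ψ Λ N G q₂ ↔
      q₁ ∈ (letI := torsionTranslation hG; AddAction.orbit (torusTorsion Λ N) q₂) := by
  letI := torsionTranslation hG
  constructor
  · intro h
    obtain ⟨⟨J₁, t₁⟩, rfl⟩ := surjective_familyMk q₁
    obtain ⟨⟨J₂, t₂⟩, rfl⟩ := surjective_familyMk q₂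
    rw [familyNsmul_familyMk, familyNsmul_familyMk, familyMk_eq_iff] at h
    obtain ⟨γ, hγJ, hγt⟩ := h
    -- `a₀ = t₁ - γ t₂` is `N`-torsion
    have ha₀ : t₁ - torusMap (γ : arithmeticGroup k ψ Λ) t₂ ∈ torusTorsion Λ N := by
      rw [mem_torusTorsion_iff, nsmul_sub, ← map_nsmul, hγt, sub_self]
    refine AddAction.mem_orbit_iff.2 ⟨⟨_, ha₀⟩, ?_⟩
    rw [torsionTranslation_familyMk]
    -- `[(J₂, a₀ + t₂)] = [(γ J₂, γ (a₀ + t₂))] = [(J₁, t₁)]`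
    rw [← familyMk_smul γ J₂, hγJ, map_add, torusMap_eq_self_of_le hG γ ha₀, sub_add_cancel]
  · rintro ⟨a, rfl⟩
    exact familyNsmul_torsionTranslation hG a q₂

section TorsionFree

variable [FiniteDimensional ℝ V] [DiscreteTopology Λ] [IsZLattice ℝ Λ]
variable (htf : ∀ g : G, IsOfFinOrder g → g = 1)
include htf

/-- **The translation action is free** over a torsion-free `G`: `a +ᵥ q = q` forces `a = 0`
(`t ↦ [(J, t)]` is injective). [cite: HatcherAT2002, §1.3 Prop. 1.40] -/
theorem isCancelVAdd_torsionTranslation [NeZero N] :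
    letI := torsionTranslation hG
    IsCancelVAdd (torusTorsion Λ N) (FamilySpace k ψ Λ G) := by
  letI := torsionTranslation hG
  rw [isCancelVAdd_iff_eq_zero_of_vadd_eq]
  intro a q h
  obtain ⟨⟨J, t⟩, rfl⟩ := surjective_familyMk q
  rw [torsionTranslation_familyMk] at h
  have h1 : (a : latticeTorus Λ) + t = t := familyMk_mk_injective htf J h
  exact Subtype.ext (add_eq_right.1 h1)

/-! ### §4 `N : G\B → G\B` is a Galois covering with group `N⁻¹V(ℤ)/V(ℤ)` -/

/-- ★★ **Multiplication by `N` on `G\B` is a quotient (Galois) covering map with group the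
`N`-torsion `N⁻¹V(ℤ)/V(ℤ) ≅ (ℤ/N)^{dim V}`** acting by translation, for `G ≤ Γ(N)` torsion-free and
`N ≥ 1` («`n_X` is an étale covering with group `X_n`», uniformly over Deligne's family).
[cite: Deligne1982HodgeCycles, proof of Thm. 4.8, p. 50] [cite: Lange2023AbelianVarietiesComplex, §1.1.2 Prop. 1.1.14]
[cite: HatcherAT2002, §1.3 Prop. 1.40] -/
theorem isAddQuotientCoveringMap_familyNsmul [NeZero N] :
    letI := torsionTranslation hG
    IsAddQuotientCoveringMap (familyNsmul k ψ Λ N G) (torusTorsion Λ N) := by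
  letI := torsionTranslation hG
  haveI := continuousConstVAdd_torsionTranslation hG
  haveI := properlyDiscontinuousVAdd_torsionTranslation hG
  haveI := isCancelVAdd_torsionTranslation hG htf
  haveI := t2Space_familySpace' (k := k) (ψ := ψ) (Λ := Λ) G
  haveI := locallyCompactSpace_familySpace (k := k) (ψ := ψ) (Λ := Λ) G
  exact (isQuotientMap_familyNsmul N).isAddQuotientCoveringMap_of_properlyDiscontinuousVAdd
    (fun {q₁ q₂} ↦ familyNsmul_eq_familyNsmul_iff_mem_orbit hG q₁ q₂)

/-- ★★ **Multiplication by `N` on `G\B` is a covering map** (`G ≤ Γ(N)` torsion-free, `N ≥ 1`), with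
`N^{dim V}` sheets (`ncard_preimage_familyNsmul_singleton`).
[cite: Deligne1982HodgeCycles, proof of Thm. 4.8, p. 50] [cite: Lange2023AbelianVarietiesComplex, §1.1.2 Prop. 1.1.14] -/
theorem isCoveringMap_familyNsmul [NeZero N] : IsCoveringMap (familyNsmul k ψ Λ N G) :=
  letI := torsionTranslation hG
  (isAddQuotientCoveringMap_familyNsmul hG htf).isCoveringMap

/-- `familyNsmul N` is a local homeomorphism (`G ≤ Γ(N)` torsion-free, `N ≥ 1`).
[cite: Deligne1982HodgeCycles, proof of Thm. 4.8, p. 50] -/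
theorem isLocalHomeomorph_familyNsmul [NeZero N] : IsLocalHomeomorph (familyNsmul k ψ Λ N G) :=
  (isCoveringMap_familyNsmul hG htf).isLocalHomeomorph

/-- The fibres of `N` are torsors under the `N`-torsion: each fibre is in bijection with
`N⁻¹V(ℤ)/V(ℤ)` (Mathlib's `fiberEquivAddGroup` of the quotient covering).
[cite: Lange2023AbelianVarietiesComplex, §1.1.2 Prop. 1.1.14] -/
theorem nonempty_preimage_familyNsmul_equiv [NeZero N] (q₀ : FamilySpace k ψ Λ G) :
    Nonempty (familyNsmul k ψ Λ N G ⁻¹' {q₀} ≃ torusTorsion Λ N) := by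
  letI := torsionTranslation hG
  obtain ⟨q, hq⟩ := surjective_familyNsmul N G q₀
  exact ⟨(isAddQuotientCoveringMap_familyNsmul hG htf).fiberEquivAddGroup ⟨q, hq⟩⟩

end TorsionFree

end Translation

/-! ### §5 Deligne's `ₙB`, `n ≥ 3` -/

/-- ★★ **On Deligne's `ₙB = Γ(n)\B`, `n ≥ 3`, multiplication by any `N ∣ n`, `N ≥ 1`, is a Galois
covering map with group `N⁻¹V(ℤ)/V(ℤ)`** (`Γ(n) ≤ Γ(N)` is torsion-free by Minkowski).
[cite: Deligne1982HodgeCycles, proof of Thm. 4.8, p. 50] [cite: Lange2023AbelianVarietiesComplex, §1.1.2 Prop. 1.1.14] -/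
theorem isAddQuotientCoveringMap_levelFamilyNsmul [FiniteDimensional ℝ V] [DiscreteTopology Λ]
    [IsZLattice ℝ Λ] {n : ℕ} (hn : 3 ≤ n) [NeZero N] (hNn : N ∣ n) :
    letI := torsionTranslation (k := k) (ψ := ψ) (Λ := Λ) (N := N)
      (G := (levelSubgroup k ψ Λ n).subgroupOf (arithmeticGroup k ψ Λ))
      (fun _ hg ↦ levelSubgroup_anti hNn hg)
    IsAddQuotientCoveringMap
      (familyNsmul k ψ Λ N ((levelSubgroup k ψ Λ n).subgroupOf (arithmeticGroup k ψ Λ)))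
      (torusTorsion Λ N) :=
  isAddQuotientCoveringMap_familyNsmul _ (torsionFree_levelSubgroupOf hn)

/-- ★★ On `ₙB`, `n ≥ 3`, multiplication by any `N ∣ n`, `N ≥ 1`, is a covering map of degree
`N^{dim V}`. [cite: Deligne1982HodgeCycles, proof of Thm. 4.8, p. 50] -/
theorem isCoveringMap_levelFamilyNsmul [FiniteDimensional ℝ V] [DiscreteTopology Λ]
    [IsZLattice ℝ Λ] {n : ℕ} (hn : 3 ≤ n) [NeZero N] (hNn : N ∣ n) :
    IsCoveringMap (familyNsmul k ψ Λ N ((levelSubgroup k ψ Λ n).subgroupOf (arithmeticGroup k ψ Λ))) :=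
  isCoveringMap_familyNsmul (fun _ hg ↦ levelSubgroup_anti hNn hg) (torsionFree_levelSubgroupOf hn)

end arithmeticGroup

end Literature.LinearAlgebra.QuadraticForm

end
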